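import Literature.Computability.Cryptography.PeriodFindingProg
import Literature.Computability.QuantumComplexity.QTMCircuitUniform
import Literature.Computability.Complexity.CodeFPLists
import HarnessLib

/-!
# Period finding by eigenvalue estimation of shifts, XII: the family is polynomial-time uniform

Family `PQC` / quantum-advantage barrier `PPolyOracles`; twelfth file towards the discharge of
`Literature.Barriers.QuantumAdvantage.aaronsonChen2017_lem75_quantum`. For a polynomial length
bound `q` (`ofPoly q : FParams`, `Lmax n = q(n)`), the description
`1ⁿ ↦ ⟨bin n, ⟨1^{anc n}, encode (circ n)⟩⟩` of the quantum core `family (ofPoly q)`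
(`sigmaEncode_family`, `aoCirc_eq`: a closed functional program over ranges with affine wire
arithmetic) is computed in the typed polynomial-time algebra `CodeFP` from the unary input — sizes
in unary and binary (`sizes`), the Hadamard and phase layers, the compute part (prefix writes,
fan-outs, ripple-carry adder stages), the queries, the reversed compute part — whence
**`family_isUniform`** by `QCircuitFamily.isUniform_iff_descFn_mem_FP` (Arora–Barak 2009, §6.2
Remark 6.7 and proof of Thm. 6.15: descriptions printed with counters; Bernstein–Vazirani 1997,
§8: uniform quantum circuit families).

## References

* S. Arora, B. Barak, *Computational Complexity: A Modern Approach*, CUP 2009, §1.3, §6.2 [AroraBarak2009].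
* E. Bernstein, U. Vazirani, SIAM J. Comput. 26 (1997), §8 [BernsteinVazirani1997].
-/

noncomputable section

namespace Literature.Computability.Cryptography

namespace PeriodFinding

open QuantumComplexity QuantumComplexity.RevDesc QuantumComplexity.AJLCore Complexity Complexity.CodeFP _root_.Computability
  Polynomial Function Kitaev1995
open QuantumComplexity.YaoSim (codeFP_T_un codeFP_T_nat codeFP_unMulConst)

/-! ### Bricks -/

section Bricks

variable {α β σ : Type} {eα : α → List Bool} {eβ : β → List Bool} {eσ : σ → List Bool}

/-- Raw-list length is invariant under permutations. [folklore] -/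
theorem length_rawE_eq_of_perm' (e : α → List Bool) {l₁ l₂ : List α} (h : l₁.Perm l₂) :
    (rawE e l₁).length = (rawE e l₂).length := by
  rw [length_rawE, length_rawE]
  exact (h.map _).sum_eq

/-- Folding `cons` reverses. [folklore] -/
theorem foldl_cons_eq_reverse_append' (l acc : List α) : l.foldl (fun b a => a :: b) acc = l.reverse ++ acc := by
  induction l generalizing acc with
  | nil => rfl
  | cons a l ih => rw [List.foldl_cons, ih, List.reverse_cons, List.append_assoc]; rfl

/-- **Reversal** of a raw list (as `CodeFPListKit.rawReverse`, reproved to keep the imports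
light). [cite: AroraBarak2009, §1.3] -/
theorem rawReverse' (e : α → List Bool) : CodeFP (rawE e) (rawE e) List.reverse := by
  have h := foldl₀ (eα := e) (eβ := rawE e) (step := fun a acc => a :: acc) (b₀ := []) (rawCons e) X
    (fun l₁ l₂ => by
      rw [eval_X, foldl_cons_eq_reverse_append', List.append_nil]
      calc (rawE e l₁.reverse).length = (rawE e l₁).length := length_rawE_eq_of_perm' e (List.reverse_perm l₁)
        _ ≤ (rawE e (l₁ ++ l₂)).length := length_rawE_le_of_sublist e (List.sublist_append_left l₁ l₂))
  exact h.congr fun l => by rw [foldl_cons_eq_reverse_append', List.append_nil]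

/-- **Unary multiplication.** [cite: AroraBarak2009, §1.3] -/
theorem unMul' : CodeFP (pairE unE unE) unE (fun p => p.1 * p.2) := by
  have h : CodeFP (pairE unE unE) unE (fun p => (List.replicate p.1 (List.replicate p.2 ())).flatten.length) :=
    (ulength unitE).comp ((flatten unitE).comp ((replicateOf (rawE unitE)).comp
      ((replicateUnit.comp (snd unE unE)).pair (fst unE unE))))
  exact h.congr fun p => by simp

/-- Unary products of computed maps. [folklore] -/
theorem umul' {f g : α → ℕ} (hf : CodeFP eα unE f) (hg : CodeFP eα unE g) : CodeFP eα unE (fun a => f a * g a) :=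
  unMul'.comp (hf.pair hg)

/-- Unary sums of computed maps. [folklore] -/
theorem uadd' {f g : α → ℕ} (hf : CodeFP eα unE f) (hg : CodeFP eα unE g) : CodeFP eα unE (fun a => f a + g a) :=
  unAdd.comp (hf.pair hg)

/-- Binary sums of computed maps. [folklore] -/
theorem nadd' {f g : α → ℕ} (hf : CodeFP eα natE f) (hg : CodeFP eα natE g) : CodeFP eα natE (fun a => f a + g a) :=
  natAdd.comp (hf.pair hg)

/-- Binary products of computed maps. [folklore] -/
theorem nmul' {f g : α → ℕ} (hf : CodeFP eα natE f) (hg : CodeFP eα natE g) : CodeFP eα natE (fun a => f a * g a) :=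
  natMul.comp (hf.pair hg)

/-- Binary differences of computed maps. [folklore] -/
theorem nsub' {f g : α → ℕ} (hf : CodeFP eα natE f) (hg : CodeFP eα natE g) : CodeFP eα natE (fun a => f a - g a) :=
  natSub.comp (hf.pair hg)

/-- Binary quotients of computed maps. [folklore] -/
theorem ndiv' {f g : α → ℕ} (hf : CodeFP eα natE f) (hg : CodeFP eα natE g) : CodeFP eα natE (fun a => f a / g a) :=
  natDiv.comp (hf.pair hg)

/-- Binary remainders of computed maps. [folklore] -/
theorem nmod' {f g : α → ℕ} (hf : CodeFP eα natE f) (hg : CodeFP eα natE g) : CodeFP eα natE (fun a => f a % g a) :=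
  natMod.comp (hf.pair hg)

/-- Comparisons of computed maps. [folklore] -/
theorem nlt' {f g : α → ℕ} (hf : CodeFP eα natE f) (hg : CodeFP eα natE g) : CodeFP eα bitE (fun a => decide (f a < g a)) :=
  natLt.comp (hf.pair hg)

/-- Comparisons of computed maps. [folklore] -/
theorem nle' {f g : α → ℕ} (hf : CodeFP eα natE f) (hg : CodeFP eα natE g) : CodeFP eα bitE (fun a => decide (f a ≤ g a)) :=
  natLe.comp (hf.pair hg)

/-- Equality of computed maps. [folklore] -/
theorem neq' {f g : α → ℕ} (hf : CodeFP eα natE f) (hg : CodeFP eα natE g) : CodeFP eα bitE (fun a => decide (f a = g a)) :=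
  natEq.comp (hf.pair hg)

/-- Binary constants. [folklore] -/
theorem nconst' (eα : α → List Bool) (c : ℕ) : CodeFP eα natE (fun _ => c) := const eα c

/-- **A flat-map over a computed unary range with a context.** [cite: AroraBarak2009, §1.3] -/
theorem flatMapRange {k : σ → ℕ} {f : σ × ℕ → List β} (hk : CodeFP eσ unE k) (hf : CodeFP (pairE eσ natE) (rawE eβ) f) :
    CodeFP eσ (rawE eβ) (fun s => (List.range (k s)).flatMap fun i => f (s, i)) :=
  ((flatten eβ).comp ((map hf).comp ((CodeFP.id eσ).pair (urange.comp hk)))).congr fun s => by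
    rw [List.flatMap_def]; rfl

/-- **A map over a computed unary range with a context.** [cite: AroraBarak2009, §1.3] -/
theorem mapRange {k : σ → ℕ} {f : σ × ℕ → β} (hk : CodeFP eσ unE k) (hf : CodeFP (pairE eσ natE) eβ f) :
    CodeFP eσ (rawE eβ) (fun s => (List.range (k s)).map fun i => f (s, i)) :=
  ((map hf).comp ((CodeFP.id eσ).pair (urange.comp hk))).congr fun _ => rfl

/-- Filter then map is a flat-map of optional singletons. [folklore] -/
theorem filter_map_eq_flatMap (l : List ℕ) (π : ℕ → Bool) (g : ℕ → β) :
    (l.filter π).map g = l.flatMap fun i => if π i then [g i] else [] := by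
  induction l with
  | nil => rfl
  | cons a l ih =>
    rw [List.filter_cons, List.flatMap_cons, ← ih]
    cases π a <;> simp

/-- **A filtered map over a computed unary range with a context.** [cite: AroraBarak2009, §1.3] -/
theorem filterMapRange {k : σ → ℕ} {π : σ × ℕ → Bool} {f : σ × ℕ → β} (hk : CodeFP eσ unE k)
    (hπ : CodeFP (pairE eσ natE) bitE π) (hf : CodeFP (pairE eσ natE) eβ f) :
    CodeFP eσ (rawE eβ) (fun s => ((List.range (k s)).filter fun i => π (s, i)).map fun i => f (s, i)) :=
  (flatMapRange hk (hπ.ite ((rawSingleton eβ).comp hf) (const _ []))).congr fun s => by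
    rw [filter_map_eq_flatMap]

/-- **Abstract gates from their parts.** [cite: AroraBarak2009, §6.1] -/
theorem ao_mk {b : α → Bool} {c : α → ℕ} {w : α → List ℕ} (hb : CodeFP eα bitE b) (hc : CodeFP eα natE c)
    (hw : CodeFP eα (rawE natE) w) : CodeFP eα aoE (fun a => (b a, c a, w a)) := by
  have h1 : CodeFP eα (pairE natE (listE natE)) (fun a => (c a, w a)) := hc.pair ((listOfRaw natE).comp hw)
  have h2 : CodeFP eα (pairE strE strE) (fun a => ([b a], pairE natE (listE natE) (c a, w a))) :=
    (hb.pair h1).recodeOut fun _ => rfl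
  exact (strAppend.comp h2).recodeOut fun _ => rfl

/-- A basic abstract gate on one computed wire. [folklore] -/
theorem ao_gate1 (sym : ℕ) {w : α → ℕ} (hw : CodeFP eα natE w) : CodeFP eα aoE (fun a => (false, sym, [w a])) :=
  ao_mk (const eα false) (nconst' eα sym) ((rawSingleton natE).comp hw)

end Bricks

/-! ### The sizes -/

section Sizes

variable (q : Polynomial ℕ)

/-- **The parameters from a polynomial length bound.** [folklore] -/
def ofPoly : FParams := ⟨fun n => q.eval n⟩

/-- `nL` in unary. [folklore] -/
theorem nL_un : CodeFP unE unE (fun n => nL (ofPoly q) n) := (unSucc.comp (codeFP_T_un q)).congr fun _ => rfl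

/-- `Lv` in unary. [folklore] -/
theorem Lv_un : CodeFP unE unE (fun n => Lv (ofPoly q) n) :=
  (unSucc.comp (uadd' (CodeFP.id unE) (nL_un q))).congr fun _ => rfl

/-- `Bn` in unary. [folklore] -/
theorem Bn_un : CodeFP unE unE (fun n => Bn (ofPoly q) n) :=
  ((codeFP_unMulConst 147456).comp (umul' (Lv_un q) (nL_un q))).congr fun n => by unfold Bn; ring

/-- `Ltop` in unary. [folklore] -/
theorem Ltop_un : CodeFP unE unE (fun n => Ltop (ofPoly q) n) := (uadd' (CodeFP.id unE) (nL_un q)).congr fun _ => rfl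

/-- `nU` in unary. [folklore] -/
theorem nU_un : CodeFP unE unE (fun n => nU (ofPoly q) n) := ((codeFP_unMulConst 12).comp (nL_un q)).congr fun _ => rfl

/-- `Kn` in unary. [folklore] -/
theorem Kn_un : CodeFP unE unE (fun n => Kn (ofPoly q) n) :=
  ((codeFP_unMulConst 2).comp (umul' (Lv_un q) (Bn_un q))).congr fun n => by unfold Kn; ring

/-- `plen` in unary. [folklore] -/
theorem plen_un : CodeFP unE unE (fun n => (spec (ofPoly q) n).plen) :=
  (unSucc.comp (unSucc.comp (uadd' (CodeFP.id unE) (Ltop_un q)))).congr fun _ => rfl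

/-- `k₁` in unary. [folklore] -/
theorem k₁_un : CodeFP unE unE (fun n => k₁ (spec (ofPoly q) n)) := (umul' (nU_un q) (Kn_un q)).congr fun _ => rfl

/-- `k₂` in unary. [folklore] -/
theorem k₂_un : CodeFP unE unE (fun n => k₂ (spec (ofPoly q) n)) := (umul' (nU_un q) (Ltop_un q)).congr fun _ => rfl

/-- `ssz` in unary. [folklore] -/
theorem ssz_un : CodeFP unE unE (fun n => ssz (spec (ofPoly q) n)) :=
  (uadd' (Ltop_un q) (uadd' (Ltop_un q) (unSucc.comp (Ltop_un q)))).congr fun _ => rfl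

/-- `usz` in unary. [folklore] -/
theorem usz_un : CodeFP unE unE (fun n => usz (spec (ofPoly q) n)) :=
  (uadd' (umul' (Kn_un q) (ssz_un q)) (Ltop_un q)).congr fun _ => rfl

/-- `mW` in unary. [folklore] -/
theorem mW_un : CodeFP unE unE (fun n => mW (spec (ofPoly q) n)) :=
  (uadd' (umul' (Ltop_un q) (plen_un q)) (umul' (nU_un q) (usz_un q))).congr fun _ => rfl

/-- The number of ancillas in unary. [folklore] -/
theorem anc_un : CodeFP unE unE (fun n => (k₁ (spec (ofPoly q) n) + k₂ (spec (ofPoly q) n)) + mW (spec (ofPoly q) n)) :=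
  uadd' (uadd' (k₁_un q) (k₂_un q)) (mW_un q)

end Sizes

/-! ### The addresses on codes -/

/-- The capped block length: `n + min (u / 12) q(n)`. [folklore] -/
def LofC (q : Polynomial ℕ) (n u : ℕ) : ℕ := n + min (u / 12) (q.eval n)

/-- The capped block length is the block length on the units. [folklore] -/
theorem LofC_eq (q : Polynomial ℕ) {n u : ℕ} (hu : u < nU (ofPoly q) n) : LofC q n u = LofN n u := by
  unfold LofC LofN nU nL at *
  rw [min_eq_left]
  have : u / 12 < q.eval n + 1 := by
    rw [Nat.div_lt_iff_lt_mul (by norm_num)]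
    simpa [ofPoly, mul_comm] using hu
  omega

section Addr

variable (q : Polynomial ℕ) {γ : Type} {eγ : γ → List Bool} {fn fu fs fi fj : γ → ℕ}

/-- The size functions of the family index carried by a context, in binary. [folklore] -/
theorem size_nat {sz : ℕ → ℕ} (hsz : CodeFP unE unE sz) (hn : CodeFP eγ unE fn) : CodeFP eγ natE (fun c => sz (fn c)) :=
  natOfUn.comp (hsz.comp hn)

variable (hn : CodeFP eγ unE fn) (hu : CodeFP eγ natE fu) (hs : CodeFP eγ natE fs) (hi : CodeFP eγ natE fi) (hj : CodeFP eγ natE fj)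
include hn

/-- `n` in binary. [folklore] -/
theorem n_nat : CodeFP eγ natE fn := natOfUn.comp hn

/-- `k₁ + k₂` in binary. [folklore] -/
theorem k12_nat : CodeFP eγ natE (fun c => k₁ (spec (ofPoly q) (fn c)) + k₂ (spec (ofPoly q) (fn c))) :=
  size_nat (sz := fun a => k₁ (spec (ofPoly q) a) + k₂ (spec (ofPoly q) a)) (uadd' (k₁_un q) (k₂_un q)) hn

/-- `Ltop * plen` in binary. [folklore] -/
theorem LP_nat : CodeFP eγ natE (fun c => (spec (ofPoly q) (fn c)).Ltop * (spec (ofPoly q) (fn c)).plen) :=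
  size_nat (sz := fun a => (spec (ofPoly q) a).Ltop * (spec (ofPoly q) a).plen)
    ((umul' (Ltop_un q) (plen_un q)).congr fun _ => rfl) hn

include hu hs in
/-- **Control wires on codes.** [folklore] -/
theorem ctrlA_fp : CodeFP eγ natE (fun c => ctrlA (spec (ofPoly q) (fn c)) (fn c) (fu c) (fs c)) :=
  (nadd' (n_nat hn) (nadd' hs (nmul' (size_nat (Kn_un q) hn) hu))).congr fun _ => rfl

include hu hi in
/-- **Offset wires on codes.** [folklore] -/
theorem zbitA_fp : CodeFP eγ natE (fun c => zbitA (spec (ofPoly q) (fn c)) (fn c) (fu c) (fi c)) :=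
  (nadd' (n_nat hn) (nadd' (size_nat (k₁_un q) hn) (nadd' hi (nmul' (size_nat (Ltop_un q) hn) hu)))).congr fun _ => rfl

include hj hi in
/-- **Prefix wires on codes** (`fj` the block, `fi` the position). [folklore] -/
theorem preA_fp : CodeFP eγ natE (fun c => preA (spec (ofPoly q) (fn c)) (fn c) (fj c) (fi c)) :=
  (nadd' (n_nat hn) (nadd' (k12_nat q hn) (nadd' hi (nmul' (size_nat (plen_un q) hn) hj)))).congr fun _ => rfl

include hu hs hi in
/-- **Fan-out registers on codes.** [folklore] -/
theorem dregA_fp : CodeFP eγ natE (fun c => dregA (spec (ofPoly q) (fn c)) (fn c) (fu c) (fs c) (fi c)) :=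
  (nadd' (n_nat hn) (nadd' (k12_nat q hn) (nadd' (LP_nat q hn) (nadd' (nadd' hi (nmul' (size_nat (ssz_un q) hn) hs))
    (nmul' (size_nat (usz_un q) hn) hu))))).congr fun _ => rfl

include hu hs hi in
/-- **Sum registers on codes.** [folklore] -/
theorem sregA_fp : CodeFP eγ natE (fun c => sregA (spec (ofPoly q) (fn c)) (fn c) (fu c) (fs c) (fi c)) :=
  (nadd' (n_nat hn) (nadd' (k12_nat q hn) (nadd' (LP_nat q hn) (nadd' (nadd' (nadd' (size_nat (Ltop_un q) hn) hi)
    (nmul' (size_nat (ssz_un q) hn) hs)) (nmul' (size_nat (usz_un q) hn) hu))))).congr fun _ => rfl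

include hu hs hi in
/-- **Carry registers on codes.** [folklore] -/
theorem cregA_fp : CodeFP eγ natE (fun c => cregA (spec (ofPoly q) (fn c)) (fn c) (fu c) (fs c) (fi c)) :=
  (nadd' (n_nat hn) (nadd' (k12_nat q hn) (nadd' (LP_nat q hn) (nadd' (nadd' (nadd' (size_nat (Ltop_un q) hn)
    (nadd' (size_nat (Ltop_un q) hn) hi)) (nmul' (size_nat (ssz_un q) hn) hs)) (nmul' (size_nat (usz_un q) hn) hu))))).congr
    fun _ => rfl

include hu hi in
/-- **Answer registers on codes.** [folklore] -/
theorem yregA_fp : CodeFP eγ natE (fun c => yregA (spec (ofPoly q) (fn c)) (fn c) (fu c) (fi c)) :=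
  (nadd' (n_nat hn) (nadd' (k12_nat q hn) (nadd' (LP_nat q hn) (nadd' (nadd' (nmul' (size_nat (Kn_un q) hn)
    (size_nat (ssz_un q) hn)) hi) (nmul' (size_nat (usz_un q) hn) hu))))).congr fun _ => rfl

include hu hs hi in
/-- **Accumulator wires on codes.** [folklore] -/
theorem accA_fp : CodeFP eγ natE (fun c => accA (spec (ofPoly q) (fn c)) (fn c) (fu c) (fs c) (fi c)) :=
  ((neq' hs (nconst' eγ 0)).ite (zbitA_fp q hn hu hi)
    (sregA_fp q hn hu (nsub' hs (nconst' eγ 1)) hi)).congr fun c => by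
      unfold accA; by_cases h : fs c = 0 <;> simp [h]

include hu in
/-- **The capped block length in unary.** [folklore] -/
theorem LofC_un : CodeFP eγ unE (fun c => LofC q (fn c) (fu c)) :=
  uadd' hn ((unOfNatMin.comp (((codeFP_T_un q).comp hn).pair (ndiv' hu (nconst' eγ 12)))).congr fun _ => rfl)

include hu in
/-- The capped block length in binary. [folklore] -/
theorem LofC_nat : CodeFP eγ natE (fun c => LofC q (fn c) (fu c)) := natOfUn.comp (LofC_un q hn hu)

include hs in
/-- **The levels on codes.** [folklore] -/
theorem lvlN_fp : CodeFP eγ natE (fun c => lvlN (ofPoly q) (fn c) (fs c)) :=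
  (ndiv' hs (nmul' (nconst' eγ 2) (size_nat (Bn_un q) hn))).congr fun _ => rfl

include hj hi in
/-- **The prefix bits on codes.** [folklore] -/
theorem cpreBit_fp : CodeFP eγ bitE (fun c => cpreBit (ofPoly q) (fn c) (fj c) (fi c)) :=
  ((nlt' hj (size_nat (Ltop_un q) hn)).and ((nlt' hi (n_nat hn)).or ((nlt' (n_nat hn) hi).and
    (nle' hi (nadd' (n_nat hn) hj))))).congr fun _ => rfl

include hj in
/-- The length of the prefix of query `j`. [folklore] -/
theorem clen_un : CodeFP eγ unE (fun c => (cpre (ofPoly q) (fn c) (fj c)).length) := by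
  have h : CodeFP eγ unE (fun c => if decide (fj c < Ltop (ofPoly q) (fn c)) then
      fn c + min (fj c) (Ltop (ofPoly q) (fn c)) + 1 + 1 else 0) :=
    (nlt' hj (size_nat (Ltop_un q) hn)).ite (unSucc.comp (unSucc.comp (uadd' hn (unOfNatMin.comp
      (((Ltop_un q).comp hn).pair hj))))) (const eγ 0)
  refine h.congr fun c => ?_
  unfold cpre
  by_cases hlt : fj c < Ltop (ofPoly q) (fn c)
  · rw [if_pos hlt, min_eq_left hlt.le]; simp [hlt]; omega
  · rw [if_neg hlt]; simp [hlt]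

end Addr

/-! ### The layers on codes -/

section Layers

variable (q : Polynomial ℕ)

/-- **The Hadamard layers on codes.** [folklore] -/
theorem had_fp {k : ℕ → ℕ} (hk : CodeFP unE unE k) : CodeFP unE (rawE aoE) (fun n => aoHad n (k n)) :=
  (mapRange hk (ao_gate1 0 (nadd' (natOfUn.comp (fst unE natE)) (snd unE natE)))).congr fun _ => rfl

/-- **The flags on codes.** [folklore] -/
theorem σN_fp : CodeFP (pairE unE natE) bitE (fun c => σN (ofPoly q) c.1 c.2) :=
  ((nlt' (snd unE natE) (size_nat (k₁_un q) (fst unE natE))).and (nle' (size_nat (Bn_un q) (fst unE natE))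
    (nmod' (nmod' (snd unE natE) (size_nat (Kn_un q) (fst unE natE))) (nmul' (nconst' _ 2)
      (size_nat (Bn_un q) (fst unE natE)))))).congr fun _ => rfl

/-- **The phase layer on codes.** [folklore] -/
theorem phase_fp : CodeFP unE (rawE aoE) (fun n => aoPhase n (k₁ (spec (ofPoly q) n) + k₂ (spec (ofPoly q) n)) (σN (ofPoly q) n)) := by
  have hg : CodeFP (pairE unE natE) aoE (fun c => (false, 1, [c.1 + c.2])) :=
    ao_gate1 1 (nadd' (natOfUn.comp (fst unE natE)) (snd unE natE))
  have h3 : CodeFP (pairE unE natE) (rawE aoE) (fun c => [(false, 1, [c.1 + c.2]), (false, 1, [c.1 + c.2]),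
      (false, 1, [c.1 + c.2])]) :=
    (rawCons aoE).comp (hg.pair ((rawCons aoE).comp (hg.pair ((rawSingleton aoE).comp hg))))
  exact (flatMapRange (uadd' (k₁_un q) (k₂_un q)) ((σN_fp q).ite h3 (const _ []))).congr fun _ => rfl

end Layers

/-! ### The compute part on codes -/

section Compute

variable (q : Polynomial ℕ)

/-- Context `(n, x)`. [folklore] -/
abbrev C1E : ℕ × ℕ → List Bool := pairE unE natE
/-- Context `((n, x), y)`. [folklore] -/
abbrev C2E : (ℕ × ℕ) × ℕ → List Bool := pairE C1E natE
/-- Context `(((n, x), y), z)`. [folklore] -/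
abbrev C3E : ((ℕ × ℕ) × ℕ) × ℕ → List Bool := pairE C2E natE

/-- Projections of the contexts. [folklore] -/
theorem c1n : CodeFP C1E unE (fun c : ℕ × ℕ => c.1) := fst unE natE
/-- Projections of the contexts. [folklore] -/
theorem c1x : CodeFP C1E natE (fun c : ℕ × ℕ => c.2) := snd unE natE
/-- Projections of the contexts. [folklore] -/
theorem c2n : CodeFP C2E unE (fun c : (ℕ × ℕ) × ℕ => c.1.1) := c1n.comp (fst C1E natE)
/-- Projections of the contexts. [folklore] -/
theorem c2x : CodeFP C2E natE (fun c : (ℕ × ℕ) × ℕ => c.1.2) := c1x.comp (fst C1E natE)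
/-- Projections of the contexts. [folklore] -/
theorem c2y : CodeFP C2E natE (fun c : (ℕ × ℕ) × ℕ => c.2) := snd C1E natE
/-- Projections of the contexts. [folklore] -/
theorem c3n : CodeFP C3E unE (fun c : ((ℕ × ℕ) × ℕ) × ℕ => c.1.1.1) := c2n.comp (fst C2E natE)
/-- Projections of the contexts. [folklore] -/
theorem c3x : CodeFP C3E natE (fun c : ((ℕ × ℕ) × ℕ) × ℕ => c.1.1.2) := c2x.comp (fst C2E natE)
/-- Projections of the contexts. [folklore] -/
theorem c3y : CodeFP C3E natE (fun c : ((ℕ × ℕ) × ℕ) × ℕ => c.1.2) := c2y.comp (fst C2E natE)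
/-- Projections of the contexts. [folklore] -/
theorem c3z : CodeFP C3E natE (fun c : ((ℕ × ℕ) × ℕ) × ℕ => c.2) := snd C2E natE

/-- The specification at the family index of a context (notation). [folklore] -/
abbrev Sq (n : ℕ) : BSpec := spec (ofPoly q) n

/-- **The prefix writes on codes.** [folklore] -/
theorem preNots_fp : CodeFP unE (rawE clopE) (fun n => preNotsN (Sq q n) n (cpreBit (ofPoly q) n)) :=
  (flatMapRange (Ltop_un q) (filterMapRange ((plen_un q).comp c1n) (cpreBit_fp q c2n c2y c2x)
    (clop_not (preA_fp q c2n c2y c2x)))).congr fun _ => rfl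

/-- The unit of step `m`: `m / K`. [folklore] -/
theorem uOf_fp : CodeFP C1E natE (fun c : ℕ × ℕ => c.2 / Kn (ofPoly q) c.1) := ndiv' c1x (size_nat (Kn_un q) c1n)
/-- The step of step `m`: `m % K`. [folklore] -/
theorem sOf_fp : CodeFP C1E natE (fun c : ℕ × ℕ => c.2 % Kn (ofPoly q) c.1) := nmod' c1x (size_nat (Kn_un q) c1n)

/-- **The fan-outs on codes.** [folklore] -/
theorem fan_fp : CodeFP C1E (rawE clopE) (fun c : ℕ × ℕ =>
    fanN (Sq q c.1) c.1 (LofC q c.1) (lvlN (ofPoly q) c.1) (c.2 / Kn (ofPoly q) c.1) (c.2 % Kn (ofPoly q) c.1)) := by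
  have hu2 : CodeFP C2E natE (fun c => c.1.2 / Kn (ofPoly q) c.1.1) := (uOf_fp q).comp (fst C1E natE)
  have hs2 : CodeFP C2E natE (fun c => c.1.2 % Kn (ofPoly q) c.1.1) := (sOf_fp q).comp (fst C1E natE)
  exact ((nlt' (lvlN_fp q c1n (sOf_fp q)) (LofC_nat q c1n (uOf_fp q))).ite
    (filterMapRange (LofC_un q c1n (uOf_fp q)) (nle' (lvlN_fp q c2n hs2) c2y)
      (clop_cnot (ctrlA_fp q c2n hu2 hs2) (dregA_fp q c2n hu2 hs2 c2y))) (const _ [])).congr fun c => by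
    unfold fanN
    by_cases h : lvlN (ofPoly q) c.1 (c.2 % Kn (ofPoly q) c.1) < LofC q c.1 (c.2 / Kn (ofPoly q) c.1) <;> simp [h]

/-- **One adder stage on codes**, for wire maps computed on `(context, bit)`. [cite: VedralBarencoEkert1996, §3.1] -/
theorem stage_fp {γ : Type} {eγ : γ → List Bool} {fa fb fs fc : γ → ℕ → ℕ}
    (ha : CodeFP (pairE eγ natE) natE (fun d => fa d.1 d.2)) (hb : CodeFP (pairE eγ natE) natE (fun d => fb d.1 d.2))
    (hs : CodeFP (pairE eγ natE) natE (fun d => fs d.1 d.2)) (hc : CodeFP (pairE eγ natE) natE (fun d => fc d.1 d.2))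
    (hc1 : CodeFP (pairE eγ natE) natE (fun d => fc d.1 (d.2 + 1))) :
    CodeFP (pairE eγ natE) (rawE clopE) (fun d => stageA (fa d.1) (fb d.1) (fs d.1) (fc d.1) d.2) :=
  (clopCons (clop_toffoli ha hb hc1) (clopCons (clop_toffoli ha hc hc1) (clopCons (clop_toffoli hb hc hc1)
    (clopCons (clop_cnot ha hs) (clopCons (clop_cnot hb hs) (clopList1 (clop_cnot hc hs))))))).congr fun _ => rfl

/-- The wire maps of the adder of step `m` on inputs of length `n` (`c = (n, m)`). [folklore] -/
def faF (c : ℕ × ℕ) (i : ℕ) : ℕ := accA (Sq q c.1) c.1 (c.2 / Kn (ofPoly q) c.1) (c.2 % Kn (ofPoly q) c.1) i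
/-- The wire maps of the adder of step `m`. [folklore] -/
def fbF (c : ℕ × ℕ) (i : ℕ) : ℕ := dregA (Sq q c.1) c.1 (c.2 / Kn (ofPoly q) c.1) (c.2 % Kn (ofPoly q) c.1) i
/-- The wire maps of the adder of step `m`. [folklore] -/
def fsF (c : ℕ × ℕ) (i : ℕ) : ℕ := sregA (Sq q c.1) c.1 (c.2 / Kn (ofPoly q) c.1) (c.2 % Kn (ofPoly q) c.1) i
/-- The wire maps of the adder of step `m`. [folklore] -/
def fcF (c : ℕ × ℕ) (i : ℕ) : ℕ := cregA (Sq q c.1) c.1 (c.2 / Kn (ofPoly q) c.1) (c.2 % Kn (ofPoly q) c.1) i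

/-- The adder of step `m` through its wire maps. [folklore] -/
theorem addN_eq_F (c : ℕ × ℕ) : addN (Sq q c.1) c.1 (LofC q c.1) (c.2 / Kn (ofPoly q) c.1) (c.2 % Kn (ofPoly q) c.1) =
    (List.range (LofC q c.1 (c.2 / Kn (ofPoly q) c.1))).flatMap fun i => stageA (faF q c) (fbF q c) (fsF q c) (fcF q c) i := rfl

/-- **The adders on codes.** [cite: VedralBarencoEkert1996, §3.1] -/
theorem add_fp : CodeFP C1E (rawE clopE) (fun c : ℕ × ℕ =>
    addN (Sq q c.1) c.1 (LofC q c.1) (c.2 / Kn (ofPoly q) c.1) (c.2 % Kn (ofPoly q) c.1)) := by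
  have hu2 : CodeFP C2E natE (fun c => c.1.2 / Kn (ofPoly q) c.1.1) := (uOf_fp q).comp (fst C1E natE)
  have hs2 : CodeFP C2E natE (fun c => c.1.2 % Kn (ofPoly q) c.1.1) := (sOf_fp q).comp (fst C1E natE)
  have ha : CodeFP C2E natE (fun d => faF q d.1 d.2) := (accA_fp q c2n hu2 hs2 c2y).congr fun _ => rfl
  have hb : CodeFP C2E natE (fun d => fbF q d.1 d.2) := (dregA_fp q c2n hu2 hs2 c2y).congr fun _ => rfl
  have hs : CodeFP C2E natE (fun d => fsF q d.1 d.2) := (sregA_fp q c2n hu2 hs2 c2y).congr fun _ => rfl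
  have hc : CodeFP C2E natE (fun d => fcF q d.1 d.2) := (cregA_fp q c2n hu2 hs2 c2y).congr fun _ => rfl
  have hc1 : CodeFP C2E natE (fun d => fcF q d.1 (d.2 + 1)) :=
    (cregA_fp q c2n hu2 hs2 (nadd' c2y (nconst' _ 1))).congr fun _ => rfl
  exact (flatMapRange (LofC_un q c1n (uOf_fp q)) (stage_fp ha hb hs hc hc1)).congr fun c => (addN_eq_F q c).symm

/-- **The steps on codes.** [folklore] -/
theorem steps_fp : CodeFP unE (rawE clopE) (fun n => stepsN (Sq q n) n (LofC q n) (lvlN (ofPoly q) n)) :=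
  (flatMapRange (umul' (nU_un q) (Kn_un q)) (clopAppend (fan_fp q) (add_fp q))).congr fun _ => rfl

/-- **The compute part on codes.** [folklore] -/
theorem wOps_fp : CodeFP unE (rawE clopE) (fun n => wOpsN (Sq q n) n (LofC q n) (lvlN (ofPoly q) n) (cpreBit (ofPoly q) n)) :=
  clopAppend (preNots_fp q) (steps_fp q)

/-! ### The queries on codes -/

/-- **One query on codes** (context `((n, u), j)`). [folklore] -/
theorem query_fp : CodeFP C2E aoE (fun c : (ℕ × ℕ) × ℕ => aoQueryN (Sq q c.1.1) c.1.1 (LofC q c.1.1) c.1.2 c.2) := by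
  have hpre : CodeFP C2E (rawE natE) (fun c => (List.range (cpre (ofPoly q) c.1.1 c.2).length).map
      fun p => preA (Sq q c.1.1) c.1.1 c.2 p) :=
    mapRange (clen_un q c2n c2y) (preA_fp q c3n c3z c3y)
  have hx : CodeFP C2E (rawE natE) (fun c => (List.range (LofC q c.1.1 c.1.2)).map
      fun i => sregA (Sq q c.1.1) c.1.1 c.1.2 (Kn (ofPoly q) c.1.1 - 1) i) :=
    mapRange (LofC_un q c2n c2x) (sregA_fp q c3n c3x (nsub' (size_nat (Kn_un q) c3n) (nconst' _ 1)) c3z)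
  have hy : CodeFP C2E (rawE natE) (fun c => [yregA (Sq q c.1.1) c.1.1 c.1.2 c.2]) :=
    (rawSingleton natE).comp (yregA_fp q c2n c2x c2y)
  exact (ao_mk (const _ true) (nadd' (natOfUn.comp (clen_un q c2n c2y)) (LofC_nat q c2n c2x))
    ((rawAppend natE).comp (((rawAppend natE).comp (hpre.pair hx)).pair hy))).congr fun _ => rfl

/-- **The queries on codes.** [folklore] -/
theorem queries_fp : CodeFP unE (rawE aoE) (fun n => queriesN (Sq q n) n (LofC q n)) :=
  (flatMapRange (nU_un q) (mapRange (LofC_un q c1n c1x) (query_fp q))).congr fun _ => rfl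

/-! ### The abstract words of the classical operations on codes -/

/-- Word templates: `X = H S S H`. [cite: NielsenChuang2010, §4.3 Fig. 4.9] -/
def tmpl0 : List (ℕ × List ℕ) := [(0, [0]), (1, [0]), (1, [0]), (0, [0])]
/-- Word templates: `CNOT`. [cite: NielsenChuang2010, §4.3 Fig. 4.9] -/
def tmpl1 : List (ℕ × List ℕ) := [(3, [0, 1])]
/-- Word templates: the Toffoli word. [cite: NielsenChuang2010, §4.3 Fig. 4.9] -/
def tmpl2 : List (ℕ × List ℕ) :=
  [(0, [2]), (2, [0]), (2, [1]), (2, [2]), (3, [0, 1]), (1, [1]), (1, [1]), (1, [1]), (2, [1]), (3, [1, 2]), (2, [2]),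
    (3, [0, 2]), (1, [2]), (1, [2]), (1, [2]), (2, [2]), (3, [1, 2]), (1, [2]), (1, [2]), (1, [2]), (2, [2]), (3, [0, 2]),
    (3, [0, 1]), (0, [2])]

/-- The template of a gate tag. [folklore] -/
def tmplOf (t : ℕ) : List (ℕ × List ℕ) := if t = 0 then tmpl0 else if t = 1 then tmpl1 else tmpl2

/-- **The abstract word of an operation from its template.** [cite: NielsenChuang2010, §4.3 Fig. 4.9] -/
theorem aoCl_eq_tmpl (op : ClOp ℕ) : aoCl op =
    (tmplOf (clopTuple op).1).map fun t => (false, t.1, t.2.map fun k => (clopTuple op).2.getD k 0) := by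
  cases op <;> rfl

/-- **The abstract words on codes.** [cite: AroraBarak2009, §6.1] -/
theorem aoCl_fp : CodeFP clopE (rawE aoE) aoCl := by
  have htm : CodeFP ctE (rawE ctE) (fun t : ℕ × List ℕ => tmplOf t.1) :=
    ((neq' (fst natE (rawE natE)) (nconst' _ 0)).ite (const _ tmpl0)
      ((neq' (fst natE (rawE natE)) (nconst' _ 1)).ite (const _ tmpl1) (const _ tmpl2))).congr fun t => by
        unfold tmplOf; by_cases h0 : t.1 = 0 <;> by_cases h1 : t.1 = 1 <;> simp [h0, h1]
  have hget : CodeFP (pairE (rawE natE) natE) natE (fun d : List ℕ × ℕ => d.1.getD d.2 0) := rawGetD natE rfl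
  have hbody : CodeFP (pairE ctE ctE) aoE (fun c : (ℕ × List ℕ) × (ℕ × List ℕ) =>
      (false, c.2.1, c.2.2.map fun k => c.1.2.getD k 0)) :=
    ao_mk (const _ false) ((fst natE (rawE natE)).comp (snd ctE ctE))
      (((map (g := fun d : List ℕ × ℕ => d.1.getD d.2 0) hget).comp
        (((snd natE (rawE natE)).comp (fst ctE ctE)).pair ((snd natE (rawE natE)).comp (snd ctE ctE)))).congr fun _ => rfl)
  have hT : CodeFP ctE (rawE aoE) (fun t : ℕ × List ℕ =>
      (tmplOf t.1).map fun tt => (false, tt.1, tt.2.map fun k => t.2.getD k 0)) :=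
    ((map hbody).comp ((CodeFP.id ctE).pair htm)).congr fun _ => rfl
  obtain ⟨f, hf, hfg⟩ := hT
  exact ⟨f, hf, fun op => by rw [show clopE op = ctE (clopTuple op) from rfl, hfg, aoCl_eq_tmpl]⟩

/-- **The abstract words of a program on codes.** [folklore] -/
theorem flatMapAoCl_fp : CodeFP (rawE clopE) (rawE aoE) (fun l => l.flatMap aoCl) :=
  ((flatten aoE).comp (map₀ aoCl_fp)).congr fun l => by rw [List.flatMap_def]

/-! ### The whole description on codes -/

/-- **The abstract gate list of the `n`-th circuit on codes** (capped block lengths). [cite: AroraBarak2009, §6.2] -/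
theorem circN_fp : CodeFP unE (rawE aoE) (fun n =>
    aoCircN (Sq q n) n (LofC q n) (lvlN (ofPoly q) n) (cpreBit (ofPoly q) n) (σN (ofPoly q) n)) := by
  have hW := (flatMapAoCl_fp).comp (wOps_fp q)
  have hR := (flatMapAoCl_fp).comp ((rawReverse' clopE).comp (wOps_fp q))
  have happ := rawAppend aoE
  exact (happ.comp ((happ.comp ((happ.comp ((had_fp (uadd' (k₁_un q) (k₂_un q))).pair
    (happ.comp ((happ.comp (hW.pair (queries_fp q))).pair hR)))).pair (phase_fp q))).pair (had_fp (k₁_un q)))).congr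
    fun _ => rfl

/-- Steps only depend on the block length of their unit. [folklore] -/
theorem stepN_congr_L (S : BSpec) (n : ℕ) {Lf Lf' : ℕ → ℕ} (lvf : ℕ → ℕ) {u : ℕ} (h : Lf u = Lf' u) (s : ℕ) :
    stepN S n Lf lvf u s = stepN S n Lf' lvf u s := by
  simp only [stepN, fanN, addN, h]

/-- The closed form only depends on the block lengths of the units. [folklore] -/
theorem aoCircN_congr_L (S : BSpec) (n : ℕ) {Lf Lf' : ℕ → ℕ} (h : ∀ u < S.nU, Lf u = Lf' u) (lvf : ℕ → ℕ)
    (cpf : ℕ → ℕ → Bool) (σ : ℕ → Bool) : aoCircN S n Lf lvf cpf σ = aoCircN S n Lf' lvf cpf σ := by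
  have hsteps : stepsN S n Lf lvf = stepsN S n Lf' lvf := by
    unfold stepsN
    refine List.flatMap_congr fun m hm => stepN_congr_L S n lvf (h _ ?_) _
    exact Nat.div_lt_of_lt_mul (by rw [Nat.mul_comm]; exact List.mem_range.1 hm)
  have hW : wOpsN S n Lf lvf cpf = wOpsN S n Lf' lvf cpf := by rw [wOpsN, wOpsN, hsteps]
  have hQ : queriesN S n Lf = queriesN S n Lf' := by
    unfold queriesN
    refine List.flatMap_congr fun u hu => ?_
    have hu' := h u (List.mem_range.1 hu)
    rw [hu']
    refine List.map_congr_left fun j _ => ?_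
    simp only [aoQueryN, hu']
  rw [aoCircN, aoCircN, hW, hQ]

/-- **The description of the family on codes.** [cite: AroraBarak2009, §6.2] -/
theorem desc_fp : CodeFP unE (pairE natE (pairE unE (rawE aoE))) (fun n =>
    (n, (k₁ (Sq q n) + k₂ (Sq q n)) + mW (Sq q n), aoCirc (Sq q n) n (famσ (ofPoly q) n))) :=
  (natOfUn.pair ((anc_un q).pair (circN_fp q))).congr fun n => by
    rw [aoCirc_eq, aoCircN_congr_L (Sq q n) n (fun u hu => (LofC_eq q hu).symm)]
    rfl

/-- **The quantum core of the distinguisher is a polynomial-time uniform family.**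
[cite: AroraBarak2009, §6.2 Remark 6.7] [cite: BernsteinVazirani1997, §8] -/
theorem family_isUniform : (family (ofPoly q)).IsUniform := by
  rw [QCircuitFamily.isUniform_iff_descFn_mem_FP]
  obtain ⟨f, hf, hfe⟩ := desc_fp q
  have h : (family (ofPoly q)).descFn = f ∘ onesFn := funext fun z => by
    rw [Function.comp_apply, QCircuitFamily.descFn, sigmaEncode_family, show onesFn z = unE z.length from rfl, hfe]
  rw [h]
  exact comp_mem_FP hf onesFn_mem_FP

end Compute

end PeriodFinding

end Literature.Computability.Cryptography

end
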